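import Literature.NumberTheory.EllipticCurves.WeightOneOrdinaryLiftProofs
import Literature.NumberTheory.EllipticCurves.EigenformPrimePowerLevelNewformProofs
import HarnessLib

/-!
# A `p`-ordinary newform of weight `≥ 2` congruent to a `p`-ordinary weight-one eigenform of
# level DIVISIBLE by `p` (Deligne–Serre 6.9–6.11 with `U_p` in the Hecke family; proofs only)

Topic `Literature/NumberTheory/EllipticCurves`; namespace
`Literature.NumberTheory.EllipticCurves.ModularForms`.  THEOREMS ONLY (no definition, no named
fact; D-0026).  The companion of `exists_ordinary_newform_congr_of_weight_one`
(`WeightOneOrdinaryLiftProofs`, level prime to `p`, where a `p`-stabilisation is needed first) for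
a weight-one eigenform whose level is already divisible by `p` and which is a `U_p`-eigenvector
with UNIT eigenvalue — the situation of a weight-one newform whose Galois representation is
ramified at `p` with a one-dimensional unramified quotient (Deligne–Serre Thm. 4.6 (b):
`a_p = χ₂(Frob_p)` is a root of unity), i.e. the ramified case of the input
[WilesOrdinary, Theorem 3] of Allen, Compos. Math. 150 (2014), Lemma 87.

**Statement** (`exists_ordinary_newform_congr_of_weight_one_of_dvd_level`).  Let `p ∣ N`,
`ι : ℚ̄_p ≃ ℂ`, and let `f ∈ S_1(N, χ)` be normalised (`a_1 = 1`) with `p`-integral coefficients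
through `ι⁻¹`, `T_q f = a_q f` for the primes `q ∤ N` and `U_p f = α f` with `ι⁻¹ α` a `p`-adic
unit.  Then there are `k ≥ 2` with `(p - 1) ∣ (k - 1)`, `L₀ ∣ N` and a NEWFORM
`g₀ ∈ S_k(Γ₁(L₀))` with `ι⁻¹ a_p(g₀) ≡ ι⁻¹ α`, `ι⁻¹ a_q(g₀) ≡ ι⁻¹ a_q` and
`ι⁻¹(ε_{g₀}(q) q^{k-1}) ≡ ι⁻¹ χ(q)` modulo `𝔪` for all primes `q ∤ N`.

**Proof.**  Steps 2–6 of `WeightOneOrdinaryLiftProofs` verbatim with `F = f` (no stabilisation):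
`G = f E_w` (`E_w ≡ 1 (mod p)`, Deligne–Serre 6.9) is an eigenvector modulo `𝔪` of the `T_q`
(`q ∤ N`) and of `U_p` (unit eigenvalue `≡ α`); the Deligne–Serre lifting lemma with `U_p` and the
diamond operators in the family (`DeligneSerreLift.exists_eigenform_of_congruence_nebentypus_congr`)
gives a genuine eigenform `g'` of weight `1 + w`; the newform behind it
(`exists_isNewform1_of_eigenpacket_of_heckeT_of_dvd_level`, any `p`-power level, non-zero
`U_p`-eigenvalue) has `a_p(g₀) = μ ≡ α` or `μ² - a_p(g₀) μ + ε(p) p^w = 0`, so `a_p(g₀) ≡ α`.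

## References

* P. Deligne, J.-P. Serre, *Formes modulaires de poids 1*, Ann. Sci. ÉNS (4) 7 (1974), 6.9–6.11
  and Thm. 4.6 (b). [DeligneSerreASENS1974]
* A. Wiles, *On ordinary `λ`-adic representations associated to modular forms*, Invent. Math. 94
  (1988), 529–573, §1 and Thm. 3. [Wiles1988]
* P. B. Allen, Compos. Math. 150 (2014), Lemma 87 (arXiv:1301.1113v2, §5.1.1, p. 70). [Allen2014]
-/

noncomputable section

open scoped MatrixGroups ModularForm

open CongruenceSubgroup UpperHalfPlane

namespace Literature.NumberTheory.EllipticCurves.ModularForms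

namespace WeightOneOrdinaryLiftRamified

variable {p : ℕ} [Fact p.Prime]

/-- Ultrametric inequality for a difference. [folklore] -/
private theorem norm_sub_le_max (x y : PadicAlgCl p) : ‖x - y‖ ≤ max ‖x‖ ‖y‖ := by
  have h := PadicAlgCl.isNonarchimedean p x (-y)
  rwa [← sub_eq_add_neg, norm_neg] at h

/-- Transitivity of `≡ (mod 𝔪)`. [folklore] -/
private theorem norm_sub_lt_one_trans {x y z : PadicAlgCl p} (h₁ : ‖x - y‖ < 1) (h₂ : ‖y - z‖ < 1) :
    ‖x - z‖ < 1 := by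
  have : x - z = (x - y) + (y - z) := by ring
  rw [this]
  exact (PadicAlgCl.isNonarchimedean p _ _).trans_lt (max_lt h₁ h₂)

/-- `‖p‖ < 1` in `ℚ̄_p`. [folklore] -/
private theorem norm_natCast_prime_lt_one : ‖(p : PadicAlgCl p)‖ < 1 := by
  rw [← map_natCast (algebraMap ℚ_[p] (PadicAlgCl p)) p]
  change ‖((p : ℚ_[p]) : PadicAlgCl p)‖ < 1
  rw [PadicAlgCl.norm_extends]
  exact Padic.norm_p_lt_one

end WeightOneOrdinaryLiftRamified

/-! ### The theorem -/

section Main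

open WeightOneOrdinaryLift WeightOneOrdinaryLiftRamified DeligneSerre1974

variable {p : ℕ} [Fact p.Prime] {N : ℕ} [NeZero N]

set_option maxHeartbeats 3200000 in
/-- **A `p`-ordinary newform of weight `≥ 2` congruent to a `p`-ordinary weight-one eigenform of
level divisible by `p`** (Deligne–Serre 1974, 6.9–6.11, with `U_p` in the Hecke family; the
classical form of Wiles 1988, Thm. 3 + specialisation in the ramified case of Allen 2014,
Lemma 87).  See the module docstring.
[cite: DeligneSerreASENS1974, 6.9–6.11] [cite: Wiles1988, §1 and Thm. 3] [cite: Allen2014, Lemma 87 (p. 70)] -/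
theorem exists_ordinary_newform_congr_of_weight_one_of_dvd_level (ι : PadicAlgCl p ≃+* ℂ)
    (hpN : p ∣ N) {χ : DirichletCharacter ℂ N} {f : CuspForm (Gamma1 N) 1}
    (hfχ : f ∈ nebentypusSubspace N 1 χ) (hf1 : cuspCoeff f 1 = 1)
    (hint : ∀ n, ‖ι.symm (cuspCoeff f n)‖ ≤ 1) {a : ℕ → ℂ}
    (hT : ∀ (q : ℕ) (hq : q.Prime), ¬ q ∣ N →
      (haveI : NeZero q := ⟨hq.ne_zero⟩; heckeT (Gamma1 N) 1 q f) = a q • f)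
    {α : ℂ} (hUf : (haveI : NeZero p := ⟨(Fact.out : p.Prime).ne_zero⟩; heckeT (Gamma1 N) 1 p f) = α • f)
    (hα : ‖ι.symm α‖ = 1) :
    ∃ (k : ℤ) (L₀ : ℕ) (_ : NeZero L₀) (_ : L₀ ∣ N) (g₀ : CuspForm (Gamma1 L₀) k),
      2 ≤ k ∧ ((p : ℤ) - 1 ∣ k - 1) ∧ IsNewform1 g₀ ∧
      ‖ι.symm (cuspCoeff g₀ p) - ι.symm α‖ < 1 ∧
      (∀ q : ℕ, q.Prime → ¬ q ∣ N → ‖ι.symm (cuspCoeff g₀ q) - ι.symm (a q)‖ < 1) ∧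
      (∀ q : ℕ, q.Prime → ¬ q ∣ N →
        ‖ι.symm (nebentypus g₀ (q : ZMod L₀) * (q : ℂ) ^ (k - 1)) - ι.symm (χ q)‖ < 1) := by
  classical
  have hp : p.Prime := Fact.out
  haveI : NeZero p := ⟨hp.ne_zero⟩
  have h1N := HeckeTGamma1.one_mem_strictPeriods_Gamma1 N
  have hnχ : ∀ x : ZMod N, ‖ι.symm (χ x)‖ ≤ 1 := fun x ↦ (norm_dirichletCharacter_le_one ι χ x).1
  -- `‖ι⁻¹ a_q‖ ≤ 1` for `q ∤ N`: `a_q = a_q(f)` in weight one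
  have haq : ∀ (q : ℕ) (hq : q.Prime), ¬ q ∣ N → a q = cuspCoeff f q := by
    intro q hq hqN
    haveI : NeZero q := ⟨hq.ne_zero⟩
    have h1 : cuspCoeff (heckeT (Gamma1 N) 1 q f) 1 = a q := by
      rw [hT q hq hqN, cuspCoeff_smul_gamma1, hf1, mul_one]
    rw [← h1, cuspCoeff_heckeT_gamma1 f q hq 1, mul_one, if_neg hqN, if_neg hq.not_dvd_one,
      mul_zero, add_zero]
  have hna : ∀ (q : ℕ), q.Prime → ¬ q ∣ N → ‖ι.symm (a q)‖ ≤ 1 := fun q hq hqN ↦ by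
    rw [haq q hq hqN]; exact hint q
  -- ### Step 1: the coefficients of `f`: `a_{pn} = α a_n` (`U_p f = α f`), Hecke relations
  have hbU : ∀ n, cuspCoeff f (p * n) = α * cuspCoeff f n := by
    intro n
    have h := congrArg (fun G ↦ cuspCoeff G n) hUf
    simp only [cuspCoeff_smul_gamma1, cuspCoeff_heckeT_gamma1 f p hp n, if_pos hpN, add_zero] at h
    exact h
  have hbT : ∀ (q : ℕ) (hq : q.Prime), ¬ q ∣ N → ∀ n,
      cuspCoeff f (q * n) + χ q * (if q ∣ n then cuspCoeff f (n / q) else 0) =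
        a q * cuspCoeff f n := by
    intro q hq hqL n
    haveI : NeZero q := ⟨hq.ne_zero⟩
    have hunit : IsUnit ((q : ℕ) : ZMod N) := (ZMod.isUnit_prime_iff_not_dvd hq).mpr hqL
    have h := congrArg (fun G ↦ cuspCoeff G n) (hT q hq hqL)
    simp only [cuspCoeff_smul_gamma1, cuspCoeff_heckeT_gamma1 f q hq n, if_neg hqL, sub_self,
      zpow_zero, one_mul] at h
    rw [← h]
    congr 1
    by_cases hqn : q ∣ n
    · rw [if_pos hqn, if_pos hqn, cuspCoeff_diamondOp_of_mem_nebentypusSubspace hfχ hunit]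
    · rw [if_neg hqn, if_neg hqn, mul_zero]
  -- ### Step 2: the Eisenstein series `E_w ≡ 1 (mod p)` and `G = f E_w ∈ S_{1+w}(Np, χ)`
  obtain ⟨w, hw3, hwev, hpw⟩ := exists_eisenstein_weight hp
  set E := ModularForm.E hw3 with hEdef
  obtain ⟨hE0, hEm⟩ := eisenstein_qExpansion_congr_one (ℓ := p) hw3 hwev hpw
  set k : ℤ := 1 + (w : ℤ) with hkdef
  have hk1 : (1 : ℤ) ≤ k := by omega
  have hk2 : (2 : ℤ) ≤ k := by omega
  have hw0 : w ≠ 0 := by omega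
  let G : CuspForm (Gamma1 N) k := f.mulModularForm (ofLevelOne (Gamma1 N) E)
  have hGq : qExpansion 1 ⇑G = qExpansion 1 ⇑f * qExpansion 1 ⇑E :=
    qExpansion_mulModularForm_ofLevelOne E f
  -- `e_j ∈ 𝔪` for `j ≠ 0`
  have hEj : ∀ j, j ≠ 0 → ‖ι.symm ((qExpansion 1 ⇑E).coeff j)‖ < 1 := by
    intro j hj
    obtain ⟨r, hr, hrj⟩ := hEm j hj
    rw [hrj, map_ratCast]
    exact norm_ratCast_lt_one_of_padicValuation_lt_one r hr
  -- `a_n(G) ≡ a_n(f) (mod 𝔪)`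
  have hcb : ∀ n, ‖ι.symm (cuspCoeff G n) - ι.symm (cuspCoeff f n)‖ < 1 := by
    intro n
    have hmul : cuspCoeff G n = ∑ ij ∈ Finset.HasAntidiagonal.antidiagonal n,
        cuspCoeff f ij.1 * (qExpansion 1 ⇑E).coeff ij.2 := by
      change (qExpansion 1 ⇑G).coeff n = _
      rw [hGq, PowerSeries.coeff_mul]
      rfl
    have hmem : (n, 0) ∈ Finset.HasAntidiagonal.antidiagonal n := by simp
    rw [hmul, ← Finset.add_sum_erase _ _ hmem, hE0, mul_one, map_add, add_sub_cancel_left, map_sum]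
    refine norm_sum_lt_one _ _ fun ij hij ↦ ?_
    obtain ⟨hne, hij'⟩ := Finset.mem_erase.mp hij
    have hj : ij.2 ≠ 0 := by
      intro h
      apply hne
      have := Finset.HasAntidiagonal.mem_antidiagonal.mp hij'
      rw [h, add_zero] at this
      exact Prod.ext this h
    rw [map_mul, norm_mul]
    exact mul_lt_one_of_nonneg_of_lt_one_right (hint _) (norm_nonneg _) (hEj _ hj)
  have hcint : ∀ n, ‖ι.symm (cuspCoeff G n)‖ ≤ 1 := fun n ↦ by
    have : ι.symm (cuspCoeff G n) =
        (ι.symm (cuspCoeff G n) - ι.symm (cuspCoeff f n)) + ι.symm (cuspCoeff f n) := by ring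
    rw [this]
    exact (PadicAlgCl.isNonarchimedean p _ _).trans (max_le (hcb n).le (hint n))
  have hc1 : ‖ι.symm (cuspCoeff G 1)‖ = 1 := by
    refine norm_eq_one_of_norm_sub_lt_one (y := ι.symm (cuspCoeff f 1)) ?_ (hcb 1)
    rw [hf1, map_one, norm_one]
  -- `G ∈ S_k(Np, χ)`
  have hfd : ∀ d : (ZMod N)ˣ, diamondOp N 1 (d : ZMod N) f = χ d • f :=
    mem_nebentypusSubspace_iff_diamondOp.mp hfχ
  have hGχ : G ∈ nebentypusSubspace N k χ := by
    rw [mem_nebentypusSubspace_iff_diamondOp]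
    intro d
    change diamondOp N (1 + (w : ℤ)) d (f.mulModularForm (ofLevelOne (Gamma1 N) E)) = _
    rw [diamondOp_mulModularForm_ofLevelOne E (d : ZMod N) f, hfd d, smul_mulModularForm]
  -- ### Step 3: `G` is an eigenvector modulo `𝔪` of the `T_q` (`q ∤ Np`) and of `U_p`
  have hcongT : ∀ (q : ℕ) (hq : q.Prime), ¬ q ∣ N → ∀ n,
      ‖ι.symm (cuspCoeff ((haveI : NeZero q := ⟨hq.ne_zero⟩; heckeT (Gamma1 N) k q) G) n) -
        ι.symm (a q) * ι.symm (cuspCoeff G n)‖ < 1 := by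
    intro q hq hqL n
    haveI : NeZero q := ⟨hq.ne_zero⟩
    have hpq : ¬ p ∣ q := fun h ↦ hqL (((Nat.prime_dvd_prime_iff_eq hp hq).mp h) ▸ hpN)
    have hunit : IsUnit ((q : ℕ) : ZMod N) := (ZMod.isUnit_prime_iff_not_dvd hq).mpr hqL
    have hzpow : ((q : ℂ)) ^ (k - 1) = (q : ℂ) ^ w := by
      rw [hkdef, show (1 : ℤ) + (w : ℤ) - 1 = ((w : ℕ) : ℤ) by omega, zpow_natCast]
    have hTG := cuspCoeff_heckeT_gamma1 G q hq n
    rw [if_neg hqL, hzpow] at hTG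
    have hrel := hbT q hq hqL n
    have e1 : ‖ι.symm (cuspCoeff G (q * n) - cuspCoeff f (q * n))‖ < 1 := by
      rw [map_sub]; exact hcb _
    have e4 : ‖ι.symm (a q * (cuspCoeff G n - cuspCoeff f n))‖ < 1 := by
      rw [map_mul, norm_mul, map_sub]
      exact mul_lt_one_of_nonneg_of_lt_one_right (hna q hq hqL) (norm_nonneg _) (hcb n)
    by_cases hqn : q ∣ n
    · rw [if_pos hqn, cuspCoeff_diamondOp_of_mem_nebentypusSubspace hGχ hunit] at hTG
      rw [if_pos hqn] at hrel
      rw [hTG]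
      have key : cuspCoeff G (q * n) + (q : ℂ) ^ w * (χ q * cuspCoeff G (n / q)) -
          a q * cuspCoeff G n =
          (cuspCoeff G (q * n) - cuspCoeff f (q * n)) +
            χ q * ((q : ℂ) ^ w - 1) * cuspCoeff G (n / q) +
            χ q * (cuspCoeff G (n / q) - cuspCoeff f (n / q)) -
            a q * (cuspCoeff G n - cuspCoeff f n) := by
        linear_combination hrel
      rw [← map_mul, ← map_sub, key, map_sub, map_add, map_add]
      have e2 : ‖ι.symm (χ q * ((q : ℂ) ^ w - 1) * cuspCoeff G (n / q))‖ < 1 := by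
        rw [map_mul, map_mul, norm_mul, norm_mul, map_sub, map_pow ι.symm, map_natCast ι.symm,
          map_one]
        exact mul_lt_one_of_nonneg_of_lt_one_left (mul_nonneg (norm_nonneg _) (norm_nonneg _))
          (mul_lt_one_of_nonneg_of_lt_one_right (hnχ _) (norm_nonneg _)
            (norm_pow_sub_one_lt_one hpq hpw)) (hcint _)
      have e3 : ‖ι.symm (χ q * (cuspCoeff G (n / q) - cuspCoeff f (n / q)))‖ < 1 := by
        rw [map_mul, norm_mul, map_sub]
        exact mul_lt_one_of_nonneg_of_lt_one_right (hnχ _) (norm_nonneg _) (hcb _)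
      refine (norm_sub_le_max _ _).trans_lt (max_lt ?_ e4)
      refine (PadicAlgCl.isNonarchimedean p _ _).trans_lt (max_lt ?_ e3)
      exact (PadicAlgCl.isNonarchimedean p _ _).trans_lt (max_lt e1 e2)
    · rw [if_neg hqn, mul_zero, add_zero] at hTG
      rw [if_neg hqn, mul_zero, add_zero] at hrel
      rw [hTG]
      have key : cuspCoeff G (q * n) - a q * cuspCoeff G n =
          (cuspCoeff G (q * n) - cuspCoeff f (q * n)) - a q * (cuspCoeff G n - cuspCoeff f n) := by
        linear_combination hrel
      rw [← map_mul, ← map_sub, key, map_sub]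
      exact (norm_sub_le_max _ _).trans_lt (max_lt e1 e4)
  have hcongU : ∀ n, ‖ι.symm (cuspCoeff (heckeT (Gamma1 N) k p G) n) -
      ι.symm α * ι.symm (cuspCoeff G n)‖ < 1 := by
    intro n
    rw [cuspCoeff_heckeT_gamma1 G p hp n, if_pos hpN, add_zero]
    have key : cuspCoeff G (p * n) - α * cuspCoeff G n =
        (cuspCoeff G (p * n) - cuspCoeff f (p * n)) - α * (cuspCoeff G n - cuspCoeff f n) := by
      rw [hbU n]; ring
    rw [← map_mul, ← map_sub, key, map_sub, map_mul, map_sub, map_sub]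
    refine (norm_sub_le_max _ _).trans_lt (max_lt (hcb (p * n)) ?_)
    rw [norm_mul, hα, one_mul]
    exact hcb n
  -- ### Step 4: Deligne–Serre lifting in `S_k(Np, χ)` with the family `{T_q : q ∤ Np} ∪ {U_p}`
  let TL : ℕ → Module.End ℂ (CuspForm (Gamma1 N) k) := fun q ↦
    if hq : q = 0 then 0 else (haveI : NeZero q := ⟨hq⟩; heckeT (Gamma1 N) k q)
  have hTL : ∀ (q : ℕ) (hq : q ≠ 0),
      TL q = (haveI : NeZero q := ⟨hq⟩; heckeT (Gamma1 N) k q) := fun q hq ↦ dif_neg hq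
  have hTLp : TL p = heckeT (Gamma1 N) k p := hTL p hp.ne_zero
  let 𝒯 : Set (Module.End ℂ (CuspForm (Gamma1 N) k)) :=
    {T | ∃ q : ℕ, (q.Prime ∧ ¬ q ∣ N ∨ q = p) ∧ T = TL q}
  have h𝒯 : ∀ T ∈ 𝒯, ∃ q : ℕ, q.Prime ∧ T = TL q := by
    rintro T ⟨q, hq, rfl⟩
    rcases hq with hq | hq
    · exact ⟨q, hq.1, rfl⟩
    · exact ⟨q, hq ▸ hp, rfl⟩
  have hcomm : ∀ S ∈ 𝒯, ∀ T ∈ 𝒯, Commute S T := by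
    intro S hS T hT'
    obtain ⟨q, hq, rfl⟩ := h𝒯 S hS
    obtain ⟨q', hq', rfl⟩ := h𝒯 T hT'
    rw [hTL q hq.ne_zero, hTL q' hq'.ne_zero]
    haveI : NeZero q := ⟨hq.ne_zero⟩
    haveI : NeZero q' := ⟨hq'.ne_zero⟩
    exact heckeT_comm_holds N k q q'
  have hdiam : ∀ T ∈ 𝒯, ∀ d : (ZMod N)ˣ,
      Commute T (diamondOp N k (d : ZMod N)) := by
    intro T hT' d
    obtain ⟨q, hq, rfl⟩ := h𝒯 T hT'
    rw [hTL q hq.ne_zero]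
    haveI : NeZero q := ⟨hq.ne_zero⟩
    exact heckeT_diamondOp_comm_holds N k q (d : ZMod N)
  have hΛ : ∀ T ∈ 𝒯, ∀ x ∈ integralLattice1 N k, T x ∈ integralLattice1 N k := by
    intro T hT' x hx
    obtain ⟨q, hq, rfl⟩ := h𝒯 T hT'
    rw [hTL q hq.ne_zero]
    haveI : NeZero q := ⟨hq.ne_zero⟩
    exact heckeT_mem_integralLattice1 hk1 hx q hq
  -- the targets: any admissible congruence class (unique modulo `𝔪`)
  let P : Module.End ℂ (CuspForm (Gamma1 N) k) → PadicAlgCl p → Prop := fun T t ↦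
    ‖t‖ ≤ 1 ∧ ∀ n, ‖ι.symm (cuspCoeff (T G) n) - t * ι.symm (cuspCoeff G n)‖ < 1
  let tg : Module.End ℂ (CuspForm (Gamma1 N) k) → PadicAlgCl p := fun T ↦
    if h : ∃ t, P T t then h.choose else 0
  have htgP : ∀ T t, P T t → P T (tg T) := by
    intro T t ht
    have h : ∃ t, P T t := ⟨t, ht⟩
    simp only [tg, dif_pos h]
    exact h.choose_spec
  have hPuniq : ∀ T t₁ t₂, P T t₁ → P T t₂ → ‖t₁ - t₂‖ < 1 := by
    intro T t₁ t₂ h₁ h₂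
    have h := norm_sub_lt_one_trans (by rw [← norm_neg, neg_sub]; exact h₁.2 1) (h₂.2 1)
    rw [← sub_mul, norm_mul, hc1, mul_one] at h
    exact h
  have hPT : ∀ (q : ℕ) (hq : q.Prime), ¬ q ∣ N → P (TL q) (ι.symm (a q)) := by
    intro q hq hqL
    refine ⟨hna q hq hqL, fun n ↦ ?_⟩
    rw [hTL q hq.ne_zero]
    exact hcongT q hq hqL n
  have hPU : P (TL p) (ι.symm α) := ⟨hα.le, fun n ↦ by rw [hTLp]; exact hcongU n⟩
  have htg : ∀ T ∈ 𝒯, ‖tg T‖ ≤ 1 := by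
    intro T _
    by_cases h : ∃ t, P T t
    · exact (htgP T _ h.choose_spec).1
    · simp only [tg, dif_neg h, norm_zero]; exact zero_le_one
  have hcongr : ∀ T ∈ 𝒯, ∀ n,
      ‖ι.symm (cuspCoeff (T G) n) - tg T * ι.symm (cuspCoeff G n)‖ < 1 := by
    rintro T ⟨q, hq, rfl⟩ n
    rcases hq with hq | hq
    · exact (htgP _ _ (hPT q hq.1 hq.2)).2 n
    · rw [hq]; exact (htgP _ _ hPU).2 n
  have hχm : χ ^ Nat.totient N = 1 := dirichletCharacter_pow_totient χ
  have hm0 : Nat.totient N ≠ 0 := (Nat.totient_pos.mpr (NeZero.pos N)).ne'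
  obtain ⟨g₁, a', hg₁0, hg₁d, hTg⟩ :=
    DeligneSerreLift.exists_eigenform_of_congruence_nebentypus_congr ι hk1 hm0 hχm 𝒯 hcomm hdiam
      hΛ tg htg hGχ hcint hc1 hcongr
  -- ### Step 5: the eigenvalues of `g₁`
  have hmemT : ∀ (q : ℕ), q.Prime → ¬ q ∣ N → TL q ∈ 𝒯 := fun q hq hqL ↦
    ⟨q, Or.inl ⟨hq, hqL⟩, rfl⟩
  have hmemU : TL p ∈ 𝒯 := ⟨p, Or.inr rfl, rfl⟩
  have ha'T : ∀ (q : ℕ), q.Prime → ¬ q ∣ N → ‖a' (TL q) - ι.symm (a q)‖ < 1 := by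
    intro q hq hqL
    exact norm_sub_lt_one_trans (hTg _ (hmemT q hq hqL)).2.1
      (hPuniq _ _ _ (htgP _ _ (hPT q hq hqL)) (hPT q hq hqL))
  have ha'U : ‖a' (TL p) - ι.symm α‖ < 1 :=
    norm_sub_lt_one_trans (hTg _ hmemU).2.1 (hPuniq _ _ _ (htgP _ _ hPU) hPU)
  have hna'U : ‖a' (TL p)‖ = 1 := norm_eq_one_of_norm_sub_lt_one hα ha'U
  have hμ0 : ι (a' (TL p)) ≠ 0 := by
    intro h0
    have h1 : a' (TL p) = 0 := by
      have := congrArg ι.symm h0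
      rwa [RingEquiv.symm_apply_apply, map_zero] at this
    rw [h1, norm_zero] at hna'U
    exact zero_ne_one hna'U
  have hU : heckeT (Gamma1 N) k p g₁ = ι (a' (TL p)) • g₁ := by
    rw [← hTLp]; exact (hTg _ hmemU).2.2
  have hTg₁ : ∀ (q : ℕ) (hq : q.Prime), ¬ q ∣ N →
      (haveI : NeZero q := ⟨hq.ne_zero⟩; heckeT (Gamma1 N) k q) g₁ = ι (a' (TL q)) • g₁ := by
    intro q hq hqL
    rw [← hTL q hq.ne_zero]
    exact (hTg _ (hmemT q hq hqL)).2.2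
  -- the nebentypus of `g₁`: the character `ψ` of the diamond eigen-scalars
  choose cd hcd1 hcdm hcdχ hcdd using hg₁d
  obtain ⟨ψ, hψ, hg₁ψ⟩ := exists_mem_nebentypusSubspace_of_diamondOp_eq_smul hg₁0
    (s := fun d ↦ ι (cd d)) hcdd
  -- ### Step 6: the newform behind `g₁`
  obtain ⟨L₀, hL₀0, hL₀, g₀, hg₀, hg₀q, hg₀ψ, hg₀p⟩ :=
    exists_isNewform1_of_eigenpacket_of_heckeT_of_dvd_level hp hpN hg₁0 hg₁ψ
      (a := fun q ↦ ι (a' (TL q))) hTg₁ hμ0 hU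
  refine ⟨k, L₀, hL₀0, hL₀, g₀, hk2, ?_, hg₀, ?_, fun q hq hqL ↦ ?_, fun q hq hqL ↦ ?_⟩
  · -- `(p - 1) ∣ (k - 1) = w`
    rw [hkdef, show (1 : ℤ) + (w : ℤ) - 1 = (w : ℤ) by ring]
    obtain ⟨e, he⟩ := hpw
    refine ⟨e, ?_⟩
    rw [he, Nat.cast_mul, Nat.cast_sub hp.one_le, Nat.cast_one]
  · -- `a_p(g₀) ≡ α`
    refine norm_sub_lt_one_trans ?_ ha'U
    rcases hg₀p with ⟨-, hgp⟩ | ⟨-, hgp⟩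
    · rw [hgp, RingEquiv.symm_apply_apply, sub_self, norm_zero]
      exact zero_lt_one
    · -- `a_p(g₀) = μ + ε(p) p^{k-1} / μ`
      have hzpow : ((p : ℂ)) ^ (k - 1) = (p : ℂ) ^ w := by
        rw [hkdef, show (1 : ℤ) + (w : ℤ) - 1 = ((w : ℕ) : ℤ) by omega, zpow_natCast]
      rw [hzpow] at hgp
      set μ : ℂ := ι (a' (TL p)) with hμ_def
      have h1 : cuspCoeff g₀ p * μ = μ * μ + nebentypus g₀ (p : ZMod L₀) * (p : ℂ) ^ w := by
        linear_combination -hgp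
      have hap : cuspCoeff g₀ p = μ + nebentypus g₀ (p : ZMod L₀) * (p : ℂ) ^ w * μ⁻¹ := by
        calc cuspCoeff g₀ p = (cuspCoeff g₀ p * μ) * μ⁻¹ := by rw [mul_inv_cancel_right₀ hμ0]
          _ = (μ * μ + nebentypus g₀ (p : ZMod L₀) * (p : ℂ) ^ w) * μ⁻¹ := by rw [h1]
          _ = μ + nebentypus g₀ (p : ZMod L₀) * (p : ℂ) ^ w * μ⁻¹ := by
            rw [add_mul, mul_inv_cancel_right₀ hμ0]
      rw [hap, map_add, map_mul, map_mul, map_inv₀, hμ_def, RingEquiv.symm_apply_apply,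
        add_sub_cancel_left, norm_mul, norm_mul, norm_inv, hna'U, inv_one, mul_one, map_pow ι.symm,
        map_natCast ι.symm, norm_pow]
      exact mul_lt_one_of_nonneg_of_lt_one_right (norm_dirichletCharacter_le_one ι _ _).1
        (pow_nonneg (norm_nonneg _) _) (pow_lt_one₀ (norm_nonneg _) norm_natCast_prime_lt_one hw0)
  · -- `a_q(g₀) ≡ a_q`
    simp only [hg₀q q hq hqL, RingEquiv.symm_apply_apply]
    exact ha'T q hq hqL
  · -- `ε_{g₀}(q) q^{k-1} ≡ χ(q)`
    have hpq : ¬ p ∣ q := fun h ↦ hqL (((Nat.prime_dvd_prime_iff_eq hp hq).mp h) ▸ hpN)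
    have hcopZ : IsCoprime (q : ℤ) ((N : ℕ) : ℤ) :=
      Nat.isCoprime_iff_coprime.2 ((Nat.Prime.coprime_iff_not_dvd hq).2 hqL)
    obtain ⟨u, hu⟩ := (ZMod.isUnit_prime_iff_not_dvd hq).mpr hqL
    have hε : nebentypus g₀ (q : ZMod L₀) = ι (cd u) := by
      have h := DirichletCharacter.changeLevel_eq_cast_of_dvd' (nebentypus g₀) hL₀ hcopZ
      simp only [Int.cast_natCast] at h
      rw [← h, hg₀ψ, ← hu]
      exact hψ u
    have hzpow : ((q : ℂ)) ^ (k - 1) = (q : ℂ) ^ w := by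
      rw [hkdef, show (1 : ℤ) + (w : ℤ) - 1 = ((w : ℕ) : ℤ) by omega, zpow_natCast]
    have hχu : χ (q : ZMod N) = χ u := by rw [hu]
    rw [hε, hzpow, hχu, map_mul, RingEquiv.symm_apply_apply, map_pow ι.symm, map_natCast ι.symm]
    have key : cd u * (q : PadicAlgCl p) ^ w - ι.symm (χ u) =
        cd u * ((q : PadicAlgCl p) ^ w - 1) + (cd u - ι.symm (χ u)) := by ring
    rw [key]
    refine (PadicAlgCl.isNonarchimedean p _ _).trans_lt (max_lt ?_ (hcdχ u))
    rw [norm_mul]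
    exact mul_lt_one_of_nonneg_of_lt_one_right (hcd1 u) (norm_nonneg _)
      (norm_pow_sub_one_lt_one hpq hpw)

end Main

end Literature.NumberTheory.EllipticCurves.ModularForms

end
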